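import Mathlib
import HarnessLib
import Literature.MathematicalPhysics.QuantumManyBody.PeriodicBoseGas
import Literature.MathematicalPhysics.QuantumManyBody.PeriodicBoseGasFourier
import Summits.AtomisticToContinuum.BoseEinsteinCondensation.Theses.BECConjugateDomination

/-!
# Crux-ideate sketch (ideator 2, round 1) for crux `PuffFloor` (stmt-AtomisticToContinuum-11785)

First lemmas of the idea card `coupling-slope-pocket` (Hellmann–Feynman / variational slope of the
ground-state energy along `H(v) - t ∑ W`, paid by stability / no-collapse of the "pocket potential"
`v - tW`, where `W(x) = |x|² ‖D²ṽ(x)‖` is the Puff pair weight).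

Nothing here is proved; every statement must only ELABORATE over existing declarations.
-/

namespace Summit.AtomisticToContinuum.BoseEinsteinCondensation.Cruxes.PuffFloor.IdeatorSketch2

open scoped BigOperators ENNReal
open MeasureTheory Filter
open Literature.MathematicalPhysics.QuantumManyBody.BoseGas

/-- The Puff pair weight as a radial profile: `w(r) = r² ‖D²ṽ(r e₀)‖` (`ṽ(x) = v(|x|)`), read as an
`ℝ≥0∞`-valued "potential" so that `periodicInteraction w L X = ∑_{i<j} w^per(xᵢ - xⱼ)`. -/
noncomputable def puffWeight (v : ℝ → ℝ≥0∞) (r : ℝ) : ℝ≥0∞ :=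
  ENNReal.ofReal (r ^ 2 *
    ‖iteratedFDeriv ℝ 2 (fun x : Space => (v ‖x‖).toReal) (r • EuclideanSpace.single (0 : Fin 3) (1 : ℝ))‖)

/-- **First lemma (Tier 1, "PocketStability"; classical, provable now).** For a smooth-class `v`
with a positive core (`0 < v 0`) and range `R₀`, the pocket potential `v - t W` (negative only where
`v < t²R₀⁴Cₑ²`, to depth `≤ t²R₀⁴Cₑ²/4`) is classically stable with constant `K t²` by cube counting,
hence as quadratic forms on periodic trial states, uniformly in `N` and `L`:
`t ⟨Ψ, ∑_{i<j} W^per(xᵢ-xⱼ) Ψ⟩ ≤ ⟨Ψ, H(v) Ψ⟩ + K t² N` for all `0 < t ≤ t₀`. -/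
def PocketStability : Prop :=
  ∀ v : ℝ → ℝ≥0∞, IsRepulsiveFiniteRange v → (∀ r, v r ≠ ⊤) →
    ContDiff ℝ 2 (fun x : Space => (v ‖x‖).toReal) →
    (∃ Cₑ : ℝ, ∀ x : Space, ‖iteratedFDeriv ℝ 2 (fun x : Space => (v ‖x‖).toReal) x‖
        ≤ Cₑ * Real.sqrt ((v ‖x‖).toReal)) →
    0 < v 0 →
    ∀ R₀ : ℝ, 0 < R₀ → (∀ r, R₀ < r → v r = 0) →
    ∃ t₀ K : ℝ, 0 < t₀ ∧ 0 ≤ K ∧ ∀ t : ℝ, 0 < t → t ≤ t₀ →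
      ∀ N : ℕ, ∀ L : ℝ, 2 * R₀ < L → ∀ Ψ : PeriodicTrialState N L,
        ENNReal.ofReal t *
            ∫⁻ X in cellN N L, periodicInteraction (puffWeight v) L X * (‖Ψ.ψ X‖₊ : ℝ≥0∞) ^ 2
          ≤ periodicEnergy v Ψ + ENNReal.ofReal (K * t ^ 2 * N)

/-- **Tier-1 consequence ("PocketPairCountHalf", provable from `PocketStability` + the constant
trial state `E₀ ≤ ½ρ‖ṽ‖₁N`, choosing `t = √ρ`).** For the positive minimiser the Puff pair
functional is `O(√ρ) N`: `⟨∑_{i<j} W(xᵢ-xⱼ)⟩_{Ψ₀} ≤ C √ρ N`. With Puff's cubic moment this gives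
the WEAKENED floor `S_m ≥ |k|/√(|k|² + C'√ρ)` (not the crux, but what the glue tolerates). -/
def PocketPairCountHalf : Prop :=
  ∀ v : ℝ → ℝ≥0∞, IsRepulsiveFiniteRange v → (∀ r, v r ≠ ⊤) →
    ContDiff ℝ 2 (fun x : Space => (v ‖x‖).toReal) →
    (∃ Cₑ : ℝ, ∀ x : Space, ‖iteratedFDeriv ℝ 2 (fun x : Space => (v ‖x‖).toReal) x‖
        ≤ Cₑ * Real.sqrt ((v ‖x‖).toReal)) →
    0 < v 0 →
    ∃ C : ℝ, 0 ≤ C ∧ ∃ ρ₀ : ℝ, 0 < ρ₀ ∧ ∀ ρ : ℝ, 0 < ρ → ρ < ρ₀ →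
      ∀ᶠ n : ℕ in atTop, ∀ Ψ : PeriodicTrialState (n + 1) (sideLength ρ (n + 1)),
        (let L : ℝ := sideLength ρ (n + 1)
         periodicEnergy v Ψ = periodicGroundStateEnergy v (n + 1) L →
         periodicEnergy v Ψ ≠ ⊤ →
         ∫⁻ X in cellN (n + 1) L, periodicInteraction (puffWeight v) L X * (‖Ψ.ψ X‖₊ : ℝ≥0∞) ^ 2
           ≤ ENNReal.ofReal (C * Real.sqrt ρ * ((n : ℝ) + 1)))

/-- **Tier-2 anchor ("PocketNoCollapse"; the residual of the line for the crux VERBATIM).** At ONE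
fixed coupling `t > 0` the pocket gas does not collapse below `-CρN` in the dilute torus limit:
`H(v) - t ∑ W ≥ -CρN` as forms, for `ρ < ρ₀` and all large `N` at `L = (N/ρ)^{1/3}`. Expected from a
dilute-gas lower bound for potentials with shallow/narrow negative parts (Yin 2010-type) or from a
`ρ`-free no-binding theorem (`C = 0`). With `E₀ ≤ ½ρ‖ṽ‖₁N` it gives `⟨∑W⟩_{Ψ₀} ≤ C'ρN/t`, i.e. the
planner's PairCountBound, hence `Θ = O(ρ)` and `PuffFloor` for positive-core `v`. -/
def PocketNoCollapse : Prop :=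
  ∀ v : ℝ → ℝ≥0∞, IsRepulsiveFiniteRange v → (∀ r, v r ≠ ⊤) →
    ContDiff ℝ 2 (fun x : Space => (v ‖x‖).toReal) →
    (∃ Cₑ : ℝ, ∀ x : Space, ‖iteratedFDeriv ℝ 2 (fun x : Space => (v ‖x‖).toReal) x‖
        ≤ Cₑ * Real.sqrt ((v ‖x‖).toReal)) →
    0 < v 0 →
    ∃ t : ℝ, 0 < t ∧ ∃ C : ℝ, 0 ≤ C ∧ ∃ ρ₀ : ℝ, 0 < ρ₀ ∧ ∀ ρ : ℝ, 0 < ρ → ρ < ρ₀ →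
      ∀ᶠ n : ℕ in atTop, ∀ Ψ : PeriodicTrialState (n + 1) (sideLength ρ (n + 1)),
        ENNReal.ofReal t *
            ∫⁻ X in cellN (n + 1) (sideLength ρ (n + 1)),
              periodicInteraction (puffWeight v) (sideLength ρ (n + 1)) X * (‖Ψ.ψ X‖₊ : ℝ≥0∞) ^ 2
          ≤ periodicEnergy v Ψ + ENNReal.ofReal (C * ρ * ((n : ℝ) + 1))

/-- **Tier-2 anchor, `ρ`-free form ("PocketNoBinding"; this ALONE closes the crux on the positive-core
sub-class).** At one fixed coupling `t₀ > 0` the pocket Hamiltonian has no negative spectrum on any large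
torus and for any particle number: `t₀ ⟨Ψ, ∑_{i<j} W^per(xᵢ-xⱼ) Ψ⟩ ≤ ⟨Ψ, H(v) Ψ⟩` for all `N`, all
`L ≥ L₀`, all periodic trial states — "a positive soft core plus an O(t₀²)-shallow attractive pocket inside the
range binds no number of bosons". With the constant trial state it gives `⟨∑W⟩_{Ψ₀} ≤ ½ρ‖ṽ‖₁N/t₀`. -/
def PocketNoBinding : Prop :=
  ∀ v : ℝ → ℝ≥0∞, IsRepulsiveFiniteRange v → (∀ r, v r ≠ ⊤) →
    ContDiff ℝ 2 (fun x : Space => (v ‖x‖).toReal) →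
    (∃ Cₑ : ℝ, ∀ x : Space, ‖iteratedFDeriv ℝ 2 (fun x : Space => (v ‖x‖).toReal) x‖
        ≤ Cₑ * Real.sqrt ((v ‖x‖).toReal)) →
    0 < v 0 →
    ∃ t₀ L₀ : ℝ, 0 < t₀ ∧ 0 < L₀ ∧ ∀ N : ℕ, ∀ L : ℝ, L₀ ≤ L → ∀ Ψ : PeriodicTrialState N L,
      ENNReal.ofReal t₀ *
          ∫⁻ X in cellN N L, periodicInteraction (puffWeight v) L X * (‖Ψ.ψ X‖₊ : ℝ≥0∞) ^ 2
        ≤ periodicEnergy v Ψ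

/-- **The slope step (trivial bookkeeping the line starts with).** If `t·⟨∑W⟩_Φ ≤ E_v(Φ) + B` for
every trial state `Φ`, then in particular for a minimiser `Ψ` (energy `E₀ ≤ ½ρ‖ṽ‖₁N` by the
constant trial state) `⟨∑W⟩_Ψ ≤ (E₀ + B)/t`. Stated here for one `N, L` as the elementary
`ℝ≥0∞` inequality it is. -/
theorem slope_step {N : ℕ} {L : ℝ} (v w : ℝ → ℝ≥0∞) (t B : ℝ≥0∞)
    (h : ∀ Φ : PeriodicTrialState N L,
      t * ∫⁻ X in cellN N L, periodicInteraction w L X * (‖Φ.ψ X‖₊ : ℝ≥0∞) ^ 2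
        ≤ periodicEnergy v Φ + B)
    (Ψ : PeriodicTrialState N L) (hΨ : periodicEnergy v Ψ = periodicGroundStateEnergy v N L) :
    t * ∫⁻ X in cellN N L, periodicInteraction w L X * (‖Ψ.ψ X‖₊ : ℝ≥0∞) ^ 2
      ≤ periodicGroundStateEnergy v N L + B := by
  simpa [hΨ] using h Ψ

/-- Sanity: the crux decl is in scope by name (the line must conclude it). -/
example : Prop := Summit.AtomisticToContinuum.BoseEinsteinCondensation.Theses.BECConjugateDomination.PuffFloor

end Summit.AtomisticToContinuum.BoseEinsteinCondensation.Cruxes.PuffFloor.IdeatorSketch2
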